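import Summits.HodgeConjecture.HodgeConjecture.Theorems.Ring2AbelianAllAndreIsogenousPencils
import Summits.HodgeConjecture.HodgeConjecture.Theorems.Ring2AbelianAllAndreIsogenousPencilsCM
import HarnessLib

/-!
# Ring 2 · sub-cell AbelianAll (ALL ABELIAN VARIETIES), André axis, part XXXIV-c — ISOGENOUS PENCILS: the CM-POINTED forms
# (the pencil's shares of the nodes `(L) CMFibreAlgebraicLift`, `(4) CMAnchoredTransport`, `(3) CMPointedPencilVHC`) of
# `ψ ≫ f'` and of `f'` AGREE, for a surjective `S`-morphism `ψ` of compact pencils of abelian varieties of the same relative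
# dimension — parts XXXIII-e (descent) + XXXIV-a (ascent) + XXXIV-b (same CM locus). FACT-FREE

HONEST FRAMING (page 1, verbatim): **research route, not a corollary; conditional on HC_CM plus one named
minimal statement.** Cell line: research route conditional on HC_CM; not a corollary; Q11.4-sentence-2 already
refuted in dim ≥ 3. Nothing in this file proves a case of the Hodge conjecture for an abelian variety; `HC_CM`, `HC_AV`
do not occur; no node is born (0 `def`), no named fact is used, no `sorry`; axioms standard; nothing is claimed minimal.

## What this part does

For compact pencils of abelian varieties `ψ ≫ f' : 𝒳 ⟶ S` and `f' : 𝒳' ⟶ S` of the same relative dimension `d` and a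
surjective `S`-morphism `ψ : 𝒳 ⟶ 𝒳'` (a fibrewise isogeny; locally quasi-finite where the lift is concerned), in the
lattice vocabulary of parts XVII / XXX (`comap j_t^* N^p(𝒳_t) ≤ N^p(𝒳) ⊔ ker j_t^*` = the lift `(L)_t(p)`;
`comap j_t^* N^p(𝒳_t) ≤ comap j_s^* N^p(𝒳_s)` = transport from `t` to `s`):

* `forall_cm_comap_le_sup_iff_of_isogenous` — **the lift at every CM point, in degree `2p`, holds for `ψ ≫ f'` iff for `f'`**
  (the pencil's share of `(L)`); `forall_cm_comap_le_comap_iff_of_isogenous` — **transport from every CM point to every point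
  holds for `ψ ≫ f'` iff for `f'`** (the share of `(4)`); `cmPointed_forall_comap_le_comap_iff_of_isogenous` — **"CM-pointed ⟹
  every class algebraic on one fibre is algebraic on all" holds for `ψ ≫ f'` iff for `f'`** (the share of `(3)`);
  `shares_iff_of_isogenous` — the three together, all degrees at once.

So on the André axis a compact pencil of abelian varieties may be replaced by any pencil fibrewise isogenous to it over the
same base: CM points, invariant algebraic classes of the fibres modulo lifted ones, and transport loci correspond. With
part XXXIII-a (retracts) and seat b05's finite étale base change this exhausts the functorialities of the pencil available in
the tree. What is NOT claimed: the node-level statements gain nothing (they quantify over all pencils); the `W`-premised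
forms of the nodes (rational `(p,p)` data on every fibre) are not transported class by class — the base-change scalars of the
tree's Gysin maps are complex numbers, not known rational — only the premise-free lattice forms in which the cell's rows
are written since part XVII; anything minimal; any case of HC. EDGE LABELS: every row K (kernel, fact-free).

References: Andre1996Motifs (§6.3, proof of Lemme 6.3.1, p. 32: «bouger s ou t par G(ℚ) change X_s, X_t en des variétés abéliennes isogènes»); DeligneHodgeII1971 (proof of Lemme 4.4.16, p. 53: «remplaçant X par un schéma abélien isogène»); Milne1999 (§2 p. 54);
Milne2020HodgeClassesAV (Prop. 1 p. 7); Abdulali1994FamiliesAV ((1.1) p. 1122); VoisinHodgeI2002 (§7.3.2 Remark 7.29).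
-/

noncomputable section

set_option linter.dupNamespace false

namespace Summit.HodgeConjecture.HodgeConjecture.Ring2.AbelianAll

open CategoryTheory CategoryTheory.Limits AlgebraicGeometry MonoidalCategory CartesianMonoidalCategory
open Literature.AlgebraicGeometry Literature.AlgebraicGeometry.Motives
open Literature.AlgebraicGeometry.HodgeTheory
open Literature.AlgebraicGeometry.Deligne1982 (cmLocus)

variable {𝒳 𝒳' S : SchemeOver ℂ} {d : ℕ} {f' : 𝒳' ⟶ S} {ψ : 𝒳 ⟶ 𝒳'}
  (hf : IsCompactAbelianPencil (ψ ≫ f') d) (hf' : IsCompactAbelianPencil f' d)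

variable [Surjective ψ.left]

include hf hf' in
/-- **The pencil's share of `(L) CMFibreAlgebraicLift` is an isogeny invariant**: the lift `(L)_t(p)` at every CM point `t`
holds for `ψ ≫ f'` iff it holds for `f'` (same CM locus, XXXIV-b; lift iff, XXXIV-a). FACT-FREE.
[cite: Milne2020HodgeClassesAV, Prop. 1 (p. 7)] [cite: Andre1996Motifs, §6.3 proof of Lemme 6.3.1 (p. 32)] -/
theorem forall_cm_comap_le_sup_iff_of_isogenous [LocallyQuasiFinite ψ.left] (p : ℕ) :
    (∀ t ∈ cmLocus (ψ ≫ f') d, (algebraicClasses (fiberOver (ψ ≫ f') t) p).comap (complexBetti.map (fiberι (ψ ≫ f') t) (2 * p)).hom ≤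
        algebraicClasses 𝒳 p ⊔ LinearMap.ker (complexBetti.map (fiberι (ψ ≫ f') t) (2 * p)).hom) ↔
      ∀ t ∈ cmLocus f' d, (algebraicClasses (fiberOver f' t) p).comap (complexBetti.map (fiberι f' t) (2 * p)).hom ≤
        algebraicClasses 𝒳' p ⊔ LinearMap.ker (complexBetti.map (fiberι f' t) (2 * p)).hom := by
  rw [cmLocus_comp_eq hf hf']
  exact forall₂_congr fun t _ ↦ comap_le_sup_iff_of_isogenous hf hf' t p

include hf hf' in
/-- **The pencil's share of `(4) CMAnchoredTransport` is an isogeny invariant**: transport from every CM point `t` to every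
point `s`, in degree `2p`, holds for `ψ ≫ f'` iff it holds for `f'`. FACT-FREE. [cite: Abdulali1994FamiliesAV, (1.1) (p. 1122)]
[cite: Andre1996Motifs, §6.3 proof of Lemme 6.3.1 (p. 32)] -/
theorem forall_cm_comap_le_comap_iff_of_isogenous (p : ℕ) :
    (∀ t ∈ cmLocus (ψ ≫ f') d, ∀ s : ComplexPoints S,
        (algebraicClasses (fiberOver (ψ ≫ f') t) p).comap (complexBetti.map (fiberι (ψ ≫ f') t) (2 * p)).hom ≤
          (algebraicClasses (fiberOver (ψ ≫ f') s) p).comap (complexBetti.map (fiberι (ψ ≫ f') s) (2 * p)).hom) ↔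
      ∀ t ∈ cmLocus f' d, ∀ s : ComplexPoints S,
        (algebraicClasses (fiberOver f' t) p).comap (complexBetti.map (fiberι f' t) (2 * p)).hom ≤
          (algebraicClasses (fiberOver f' s) p).comap (complexBetti.map (fiberι f' s) (2 * p)).hom := by
  rw [cmLocus_comp_eq hf hf']
  exact forall₂_congr fun t _ ↦ forall_congr' fun s ↦ comap_le_comap_iff_of_isogenous hf hf' t s p

include hf hf' in
/-- **The pencil's share of `(3) CMPointedPencilVHC` is an isogeny invariant**: "if the pencil has a CM point then every class
of degree `2p` algebraic on one fibre is algebraic on every fibre" holds for `ψ ≫ f'` iff it holds for `f'`. FACT-FREE.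
[cite: Andre1996Motifs, §6.3 Lemme 6.3.1 and Remarque 2 (pp. 31–33)] [cite: Abdulali1994FamiliesAV, (1.1) (p. 1122)] -/
theorem cmPointed_forall_comap_le_comap_iff_of_isogenous (p : ℕ) :
    ((cmLocus (ψ ≫ f') d).Nonempty → ∀ t s : ComplexPoints S,
        (algebraicClasses (fiberOver (ψ ≫ f') t) p).comap (complexBetti.map (fiberι (ψ ≫ f') t) (2 * p)).hom ≤
          (algebraicClasses (fiberOver (ψ ≫ f') s) p).comap (complexBetti.map (fiberι (ψ ≫ f') s) (2 * p)).hom) ↔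
      ((cmLocus f' d).Nonempty → ∀ t s : ComplexPoints S,
        (algebraicClasses (fiberOver f' t) p).comap (complexBetti.map (fiberι f' t) (2 * p)).hom ≤
          (algebraicClasses (fiberOver f' s) p).comap (complexBetti.map (fiberι f' s) (2 * p)).hom) := by
  rw [cmLocus_comp_nonempty_iff hf hf', forall_comap_le_comap_iff_of_isogenous hf hf' p]

include hf hf' in
/-- **ISOGENOUS PENCILS CARRY THE SAME ANDRÉ-AXIS CONTENT** — the shares of `(L)`, `(4)` and `(3)` in all degrees at once:
for a surjective locally quasi-finite `S`-morphism `ψ` of compact pencils of abelian varieties of the same relative dimension,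
the conjunction "lift at every CM point ∧ transport from every CM point ∧ CM-pointed variational statement", over all `p`,
holds for `ψ ≫ f'` iff it holds for `f'`. FACT-FREE. [cite: Andre1996Motifs, §6.3 proof of Lemme 6.3.1 (p. 32)] [cite: Milne2020HodgeClassesAV, Prop. 1 (p. 7)] -/
theorem shares_iff_of_isogenous [LocallyQuasiFinite ψ.left] :
    ((∀ p, ∀ t ∈ cmLocus (ψ ≫ f') d,
        (algebraicClasses (fiberOver (ψ ≫ f') t) p).comap (complexBetti.map (fiberι (ψ ≫ f') t) (2 * p)).hom ≤
          algebraicClasses 𝒳 p ⊔ LinearMap.ker (complexBetti.map (fiberι (ψ ≫ f') t) (2 * p)).hom) ∧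
      (∀ p, ∀ t ∈ cmLocus (ψ ≫ f') d, ∀ s : ComplexPoints S,
        (algebraicClasses (fiberOver (ψ ≫ f') t) p).comap (complexBetti.map (fiberι (ψ ≫ f') t) (2 * p)).hom ≤
          (algebraicClasses (fiberOver (ψ ≫ f') s) p).comap (complexBetti.map (fiberι (ψ ≫ f') s) (2 * p)).hom) ∧
      (∀ p, (cmLocus (ψ ≫ f') d).Nonempty → ∀ t s : ComplexPoints S,
        (algebraicClasses (fiberOver (ψ ≫ f') t) p).comap (complexBetti.map (fiberι (ψ ≫ f') t) (2 * p)).hom ≤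
          (algebraicClasses (fiberOver (ψ ≫ f') s) p).comap (complexBetti.map (fiberι (ψ ≫ f') s) (2 * p)).hom)) ↔
    ((∀ p, ∀ t ∈ cmLocus f' d,
        (algebraicClasses (fiberOver f' t) p).comap (complexBetti.map (fiberι f' t) (2 * p)).hom ≤
          algebraicClasses 𝒳' p ⊔ LinearMap.ker (complexBetti.map (fiberι f' t) (2 * p)).hom) ∧
      (∀ p, ∀ t ∈ cmLocus f' d, ∀ s : ComplexPoints S,
        (algebraicClasses (fiberOver f' t) p).comap (complexBetti.map (fiberι f' t) (2 * p)).hom ≤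
          (algebraicClasses (fiberOver f' s) p).comap (complexBetti.map (fiberι f' s) (2 * p)).hom) ∧
      (∀ p, (cmLocus f' d).Nonempty → ∀ t s : ComplexPoints S,
        (algebraicClasses (fiberOver f' t) p).comap (complexBetti.map (fiberι f' t) (2 * p)).hom ≤
          (algebraicClasses (fiberOver f' s) p).comap (complexBetti.map (fiberι f' s) (2 * p)).hom)) :=
  and_congr (forall_congr' fun p ↦ forall_cm_comap_le_sup_iff_of_isogenous hf hf' p)
    (and_congr (forall_congr' fun p ↦ forall_cm_comap_le_comap_iff_of_isogenous hf hf' p)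
      (forall_congr' fun p ↦ cmPointed_forall_comap_le_comap_iff_of_isogenous hf hf' p))

end Summit.HodgeConjecture.HodgeConjecture.Ring2.AbelianAll

end
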